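import Mathlib
import HarnessLib
import Summits.NavierStokesRegularity.NavierStokesRegularity.Theorems.QuarterLogPincerColdSmoothingDefs
import Summits.NavierStokesRegularity.NavierStokesRegularity.Theorems.QuarterLogPincerEmberCensusHotWitnessFar
import Summits.NavierStokesRegularity.NavierStokesRegularity.Theorems.QuarterLogPincerSmoothSilenceNormalisation
import Literature.Analysis.FluidPDE.SereginEpsilonRegularityHigherHolds
import Literature.Analysis.FluidPDE.ESSLocalHolderConcentration
import Literature.Analysis.FluidPDE.AlbrittonBarker2020LocalConcentrationBlowup

/-!
# Route `QuarterLogPincer`, crux `TypeIQuantSubcubicExp` (stmt-NavierStokesRegularity-24077), line `cold_smoothing` —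
# CS3 `stub_smallEnergySmoothing : SmallEnergySmoothing` BY NAME (ε-regularity read on classical solutions)

ns-idea-7's line `Cruxes/TypeIQuantSubcubicExp/Lines/cold_smoothing.lean` (v1.1, idea-crit-4 PASS) carries the plumbing stub CS3
`SmallEnergySmoothing` («size M; the PROVED `seregin2014_lemma61` + parabolic zoom»).  Proof, exactly as the card says, over the landed
objects (`…ColdSmoothingDefs`): zoom `U(s,y) = r·u(z₁+r²s, z₂+ry)`, `P = r²q(…)` (`IsSuitableWeakSolutionInBall.zoom_radius`); the smallness
`∫_{Q₁}(|U|³+|P|^{3/2}) = cknC r z u + cknD r z q < ε₀` (`lintegral_cube_zoom_radius`, `lintegral_pressure_zoom_radius` at `a = 1`);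
`seregin2014_lemma61_holds` gives a representative `W` of `U` on `Q(1/2)` with `‖∇ᵏW‖ ≤ c₀ k`; `U` is continuous there (classical frame;
the zoomed cylinder lies in `[0,T] × ℝ³` because `r² ≤ z₁`) and `W` is continuous (the `k = 0` Hölder clause), so `U = W` on the OPEN cylinder
(`Measure.eqOn_open_of_ae_eq`) and the derivative bounds transfer to `U` (`Filter.EventuallyEq.iteratedFDeriv`); unzoom by the tree's
`SmoothSilence.norm_iteratedFDeriv_smul_comp_affine_le` (`u(t) = r⁻¹ U(s)(r⁻¹(· − z₂))`, `‖∇ʲu‖ ≤ r^{-(j+1)}‖∇ʲU‖`); the closed time endpoints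
by continuity of the slice derivatives in time (`EmberCensus.continuousWithinAt_iteratedFDeriv_slice`) and `le_of_tendsto`;
`cs := max(1, c₀ 0, c₀ 1, c₀ 2)`, `εs := ε₀`.

HONEST FRAME: bookkeeping around the tree's ε-regularity theorem for HYPOTHETICAL Type-I classical solutions; it closes one registered
plumbing stub of a line four levels below the crux; nothing here bears on 24077's truth, W7 or Navier–Stokes regularity (OPEN / not proved).
pub-ns-dss typer (g38), `--supports stmt-NavierStokesRegularity-24077`.
-/

noncomputable section

set_option linter.dupNamespace false

namespace Summit.NavierStokesRegularity.NavierStokesRegularity.Cruxes.TypeIQuantSubcubicExp.ColdSmoothing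

open MeasureTheory Set Function Filter Topology Metric
open scoped ENNReal NNReal
open Literature.Analysis Literature.Analysis.FluidPDE
open Summit.NavierStokesRegularity.NavierStokesRegularity.Cruxes.TypeIQuantSubcubicExp.EmberCensus
  (continuousWithinAt_iteratedFDeriv_slice)
open Summit.NavierStokesRegularity.NavierStokesRegularity.Cruxes.TypeIQuantSubcubicExp.SmoothSilence
  (norm_iteratedFDeriv_smul_comp_affine_le)

/-- **CS3 — `stub_smallEnergySmoothing : SmallEnergySmoothing` (BY NAME)**, with `εs := ε₀` and `cs := max(1, c₀ 0, c₀ 1, c₀ 2)` from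
`seregin2014_lemma61_holds`. -/
theorem stub_smallEnergySmoothing : SmallEnergySmoothing := by
  obtain ⟨ε₀, hε₀, c₀, H⟩ := seregin2014_lemma61_holds
  refine ⟨ε₀, max 1 (max (c₀ 0) (max (c₀ 1) (c₀ 2))), hε₀, le_max_left _ _, ?_⟩
  intro T u p q hframe z r hr hrz hzT hsuit hsmall t ht x hx j hj
  set cs : ℝ := max 1 (max (c₀ 0) (max (c₀ 1) (c₀ 2))) with hcs
  have hcj : c₀ j ≤ cs := by
    interval_cases j
    · exact le_max_of_le_right (le_max_left _ _)
    · exact le_max_of_le_right (le_max_of_le_right (le_max_left _ _))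
    · exact le_max_of_le_right (le_max_of_le_right (le_max_right _ _))
  have hr2 : 0 < r ^ 2 := by positivity
  have hz0 : 0 < z.1 := lt_of_lt_of_le hr2 hrz
  have hT : 0 < T := lt_of_lt_of_le hz0 hzT
  -- ## the zoomed pair `U(s,y) = r u(z₁ + r² s, z₂ + r y)`, `P = r² q(…)`
  set U : ℝ → (EuclideanSpace ℝ (Fin 3)) → (EuclideanSpace ℝ (Fin 3)) := r • stPull (r ^ 2) r z.1 z.2 u with hU
  set P : ℝ → (EuclideanSpace ℝ (Fin 3)) → ℝ := r ^ 2 • stPull (r ^ 2) r z.1 z.2 q with hP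
  have hsuit1 : IsSuitableWeakSolutionInBall 1 (0 : ℝ × (EuclideanSpace ℝ (Fin 3))) U P := by
    have h := hsuit.zoom_radius hr
    rwa [div_self hr.ne'] at h
  -- `U` is continuous on the zoomed cylinders `Q_a(0)`, `a ≤ 1` (they lie in the frame since `r² ≤ z₁`)
  have hu0 : ContinuousOn (uncurry u) (Icc 0 T ×ˢ univ) := hframe.1.smooth_velocity.continuousOn
  have hAff : Continuous (stAffine (r ^ 2) r z.1 z.2 :
      ℝ × (EuclideanSpace ℝ (Fin 3)) → ℝ × (EuclideanSpace ℝ (Fin 3))) := by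
    unfold stAffine
    fun_prop
  have hUc : ∀ a : ℝ, 0 < a → a ≤ 1 →
      ContinuousOn (uncurry U) (parabolicCylinder a (0 : ℝ × (EuclideanSpace ℝ (Fin 3)))) := by
    intro a ha ha1
    have hmaps : MapsTo (stAffine (r ^ 2) r z.1 z.2) (parabolicCylinder a (0 : ℝ × (EuclideanSpace ℝ (Fin 3))))
        (Icc 0 T ×ˢ univ) := by
      intro w hw
      rw [mem_parabolicCylinder] at hw
      have h1 : -a ^ 2 < w.1 := by have h := hw.1.1; simpa using h
      have h2 : w.1 < 0 := by have h := hw.1.2; simpa using h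
      have ha2 : a ^ 2 ≤ 1 := by nlinarith
      refine ⟨⟨?_, ?_⟩, mem_univ _⟩
      · show 0 ≤ z.1 + r ^ 2 * w.1
        nlinarith
      · show z.1 + r ^ 2 * w.1 ≤ T
        nlinarith
    have e : uncurry U = fun w => r • uncurry u (stAffine (r ^ 2) r z.1 z.2 w) := by
      funext w
      rfl
    rw [e]
    exact (hu0.comp hAff.continuousOn hmaps).const_smul r
  -- ## smallness at unit scale: `∫_{Q₁}(|U|³ + |P|^{3/2}) = cknC r z u + cknD r z q < ε₀`
  have hsmall1 : ∫⁻ w in parabolicCylinder 1 (0 : ℝ × (EuclideanSpace ℝ (Fin 3))),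
      (‖U w.1 w.2‖ₑ ^ (3 : ℕ) + ‖P w.1 w.2‖ₑ ^ (3 / 2 : ℝ)) < ENNReal.ofReal ε₀ := by
    have hmeas : AEMeasurable (fun w : ℝ × (EuclideanSpace ℝ (Fin 3)) => ‖U w.1 w.2‖ₑ ^ (3 : ℕ))
        (volume.restrict (parabolicCylinder 1 (0 : ℝ × (EuclideanSpace ℝ (Fin 3))))) :=
      (((hUc 1 one_pos le_rfl).aemeasurable (isOpen_parabolicCylinder _ _).measurableSet).enorm.pow_const _)
    rw [lintegral_add_left' hmeas]
    have e1 : ∫⁻ w in parabolicCylinder 1 (0 : ℝ × (EuclideanSpace ℝ (Fin 3))), ‖U w.1 w.2‖ₑ ^ (3 : ℕ) =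
        cknC r z u := by
      have h := lintegral_cube_zoom_radius hr one_pos z u
      rw [one_mul, ENNReal.ofReal_one, one_pow, one_mul] at h
      simpa only [Prod.mk_zero_zero] using h
    have e2 : ∫⁻ w in parabolicCylinder 1 (0 : ℝ × (EuclideanSpace ℝ (Fin 3))), ‖P w.1 w.2‖ₑ ^ (3 / 2 : ℝ) =
        cknD r z q := by
      have h := lintegral_pressure_zoom_radius hr one_pos z q
      rw [one_mul, ENNReal.ofReal_one, one_pow, one_mul] at h
      simpa only [Prod.mk_zero_zero] using h
    rw [e1, e2]
    exact hsmall
  -- ## ε-regularity: a smooth representative `W` of `U` on `Q(1/2)`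
  obtain ⟨W, hae, -, hWk⟩ := H U P hsuit1 hsmall1
  have hQo : IsOpen (parabolicCylinder (1 / 2) (0 : ℝ × (EuclideanSpace ℝ (Fin 3)))) := isOpen_parabolicCylinder _ _
  have hWc : ContinuousOn (uncurry W) (parabolicCylinder (1 / 2) (0 : ℝ × (EuclideanSpace ℝ (Fin 3)))) := by
    obtain ⟨C, α, hα, hH⟩ := (hWk 0).1
    have h0 := hH.continuousOn hα
    have h1 : ContinuousOn (fun w : ℝ × (EuclideanSpace ℝ (Fin 3)) =>
        (iteratedFDeriv ℝ 0 (W w.1) w.2) (0 : Fin 0 → EuclideanSpace ℝ (Fin 3)))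
        (parabolicCylinder (1 / 2) (0 : ℝ × (EuclideanSpace ℝ (Fin 3)))) :=
      (continuous_eval_const (0 : Fin 0 → EuclideanSpace ℝ (Fin 3))).comp_continuousOn h0
    refine h1.congr fun w _ => ?_
    show W w.1 w.2 = iteratedFDeriv ℝ 0 (W w.1) w.2 0
    rw [iteratedFDeriv_zero_apply]
  have hUW : EqOn (uncurry U) (uncurry W) (parabolicCylinder (1 / 2) (0 : ℝ × (EuclideanSpace ℝ (Fin 3)))) :=
    Measure.eqOn_open_of_ae_eq hae hQo (hUc (1 / 2) (by norm_num) (by norm_num)) hWc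
  -- the derivative bounds transfer to `U` on the open cylinder
  have hinner : ∀ s ∈ Ioo (-(1 / 2 : ℝ) ^ 2) 0, ∀ y ∈ ball (0 : EuclideanSpace ℝ (Fin 3)) (1 / 2), ∀ k : ℕ,
      ‖iteratedFDeriv ℝ k (U s) y‖ ≤ c₀ k := by
    intro s hs y hy k
    have hmem : ∀ y' ∈ ball (0 : EuclideanSpace ℝ (Fin 3)) (1 / 2),
        (s, y') ∈ parabolicCylinder (1 / 2) (0 : ℝ × (EuclideanSpace ℝ (Fin 3))) := by
      intro y' hy'
      rw [mem_parabolicCylinder]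
      refine ⟨⟨by simpa using hs.1, by simpa using hs.2⟩, by simpa using hy'⟩
    have hev : U s =ᶠ[𝓝 y] W s := by
      filter_upwards [isOpen_ball.mem_nhds hy] with y' hy'
      exact hUW (hmem y' hy')
    rw [(hev.iteratedFDeriv ℝ k).eq_of_nhds]
    exact (hWk k).2 (s, y) (hmem y hy)
  -- ## unzoom on the open time interval
  have hint : ∀ t' ∈ Ioo (z.1 - (r / 2) ^ 2) z.1,
      ‖iteratedFDeriv ℝ j (u t') x‖ ≤ cs * r ^ (-((j : ℝ) + 1)) := by
    intro t' ht'
    set s : ℝ := (t' - z.1) / r ^ 2 with hs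
    have hsI : s ∈ Ioo (-(1 / 2 : ℝ) ^ 2) 0 := by
      refine ⟨?_, div_neg_of_neg_of_pos (by linarith [ht'.2]) hr2⟩
      rw [hs, lt_div_iff₀ hr2]
      have e : -(1 / 2 : ℝ) ^ 2 * r ^ 2 = -(r / 2) ^ 2 := by ring
      rw [e]
      linarith [ht'.1]
    have hyI : (-r⁻¹) • z.2 + r⁻¹ • x ∈ ball (0 : EuclideanSpace ℝ (Fin 3)) (1 / 2) := by
      have e : (-r⁻¹) • z.2 + r⁻¹ • x = r⁻¹ • (x - z.2) := by
        rw [smul_sub, neg_smul]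
        abel
      rw [e, mem_ball_zero_iff, norm_smul, Real.norm_eq_abs, abs_of_pos (inv_pos.2 hr)]
      have hxn : ‖x - z.2‖ < r / 2 := by rw [← mem_ball_iff_norm]; exact hx
      calc r⁻¹ * ‖x - z.2‖ < r⁻¹ * (r / 2) := mul_lt_mul_of_pos_left hxn (inv_pos.2 hr)
        _ = 1 / 2 := by field_simp
    have hfun : (fun w => r⁻¹ • U s ((-r⁻¹) • z.2 + r⁻¹ • w)) = u t' := by
      funext w
      show r⁻¹ • (r • u (z.1 + r ^ 2 * s) (z.2 + r • ((-r⁻¹) • z.2 + r⁻¹ • w))) = u t' w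
      have e1 : z.1 + r ^ 2 * s = t' := by
        rw [hs]
        field_simp
        ring
      have e2 : z.2 + r • ((-r⁻¹) • z.2 + r⁻¹ • w) = w := by
        simp only [smul_add, smul_neg, neg_smul, smul_smul, mul_inv_cancel₀ hr.ne', one_smul,
          add_neg_cancel_left]
      rw [e1, e2, smul_smul, inv_mul_cancel₀ hr.ne', one_smul]
    have h1 := norm_iteratedFDeriv_smul_comp_affine_le (U s) r⁻¹ (inv_ne_zero hr.ne') ((-r⁻¹) • z.2) j x
    rw [hfun] at h1
    have h2 := hinner s hsI _ hyI j
    have hrj : |r⁻¹| * |r⁻¹| ^ j = r ^ (-((j : ℝ) + 1)) := by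
      have e : ((j : ℝ) + 1) = ((j + 1 : ℕ) : ℝ) := by push_cast; ring
      rw [abs_of_pos (inv_pos.2 hr), Real.rpow_neg hr.le, e, Real.rpow_natCast, ← inv_pow, pow_succ,
        mul_comm]
    calc ‖iteratedFDeriv ℝ j (u t') x‖
        ≤ |r⁻¹| * |r⁻¹| ^ j * ‖iteratedFDeriv ℝ j (U s) ((-r⁻¹) • z.2 + r⁻¹ • x)‖ := h1
      _ ≤ |r⁻¹| * |r⁻¹| ^ j * c₀ j := mul_le_mul_of_nonneg_left h2 (by positivity)
      _ ≤ r ^ (-((j : ℝ) + 1)) * cs := by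
          rw [hrj]
          exact mul_le_mul_of_nonneg_left hcj (Real.rpow_nonneg hr.le _)
      _ = cs * r ^ (-((j : ℝ) + 1)) := mul_comm _ _
  -- ## the closed time endpoints by continuity of the slice derivatives in time
  have hsub : Ioo (z.1 - (r / 2) ^ 2) z.1 ⊆ Icc 0 T := by
    intro t' ht'
    exact ⟨by nlinarith [ht'.1], ht'.2.le.trans hzT⟩
  have htI : t ∈ Icc 0 T := ⟨by nlinarith [ht.1], ht.2.trans hzT⟩
  have hcw : ContinuousWithinAt (fun τ => iteratedFDeriv ℝ j (u τ) x) (Ioo (z.1 - (r / 2) ^ 2) z.1) t :=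
    (continuousWithinAt_iteratedFDeriv_slice (uniqueDiffOn_Icc hT) hframe.1.smooth_velocity j x htI).mono hsub
  have hne : (𝓝[Ioo (z.1 - (r / 2) ^ 2) z.1] t).NeBot := by
    rw [← mem_closure_iff_nhdsWithin_neBot, closure_Ioo (by nlinarith : z.1 - (r / 2) ^ 2 ≠ z.1)]
    exact ht
  exact le_of_tendsto hcw.tendsto.norm (eventually_nhdsWithin_of_forall fun τ hτ => hint τ hτ)

end Summit.NavierStokesRegularity.NavierStokesRegularity.Cruxes.TypeIQuantSubcubicExp.ColdSmoothing

end
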